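import Summits.RiemannHypothesis.RiemannHypothesis.Theses.SignCone
import Summits.RiemannHypothesis.RiemannHypothesis.Theorems.SignConeConeMagnificationCompactness
import Literature.NumberTheory.LFunctions.WeilExplicit
import Literature.NumberTheory.LFunctions.GeneralizedRH
import Summits.RiemannHypothesis.RiemannHypothesis.Theorems.SignConeConeMagnificationKernel
import Summits.RiemannHypothesis.RiemannHypothesis.Theorems.SignConeExactConeRigidityCaratheodory

/-!
# Stub `stub_pdLaplace` of line `Sketch` for crux `SignCone.ConeMagnification`
(item stmt-RiemannHypothesis-16303, route route-RiemannHypothesis-SignCone)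

POSITIVE-DEFINITENESS ⇒ CARATHÉODORY POSITIVITY OF THE TRANSLATE FORM.  Let `c ≥ 0` be a weight on `ℕ`
with unit slack against every Weil test, `-‖φ‖₂² ≤ Re (W_ar - P_c)(φ ⋆ φ̃)`
(`W_ar = weilPolarTerm + weilArchTerm`, `P_c(K) = Σₙ c(n) n^{-1/2}(K(log n) + K(-log n))`).  For a Weil test
`g` with autocorrelation `K = g ⋆ g̃ = weilConv g (weilReflect g)` put
`f(y) := K(-y) + W_ar(K(· - y)) - P_c(K(· - y))` (`K(· - y) = weilTranslate K y`).  Then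
`0 ≤ Re ∫₀^∞ f(y) e^{-zy} dy` for every `Re z > 0`.

Proof.  `f` is continuous, bounded (`‖f(y)‖ ≤ Re f(0)`, the `γ`-trick), hermitian (`f(-y) = conj f(y)`,
since `K̃ = K`) and POSITIVE-DEFINITE: unit slack applied to the comb `Σⱼ zⱼ g(· - xⱼ)`, whose
autocorrelation is `Σ_{j,k} zⱼ conj(z_k) K(· - (xⱼ - x_k))`, gives `0 ≤ Re Σ_{j,k} zⱼ conj(z_k) f(xⱼ - x_k)` by
linearity of the form.  The half-plane Herglotz–Bochner lemma `re_laplace_nonneg_of_posDef` (Riemann sums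
`xⱼ = jδ`, `zⱼ = e^{-zjδ}`, Toeplitz positivity and `δ → 0`) then yields the claim.  All of this is the case
`κ = 1` of the landed `κ`-slack Carathéodory positivity
`SignConeExactConeRigidity.re_laplace_fakeForm_translate_nonneg`
(`Theorems/SignConeExactConeRigidityCaratheodory.lean`); here we only match the hypothesis
(`-(1 · ‖φ‖₂²) = -‖φ‖₂²`) and the integrand (`K(-y) + W_ar - P_c = W_ar - P_c + 1 · K(-y)`).
-/

noncomputable section

-- `Summit.RiemannHypothesis.RiemannHypothesis.…` repeats a namespace component by design (D-0017 layout).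
set_option linter.dupNamespace false

open scoped BigOperators ComplexConjugate Topology
open Complex MeasureTheory Set Filter

namespace Summit.RiemannHypothesis.RiemannHypothesis.Theorems.SignConeConeMagnification

open Literature.NumberTheory.LFunctions
open Summit.RiemannHypothesis.RiemannHypothesis.Theorems.SignCone
open Summit.RiemannHypothesis.RiemannHypothesis.Theorems.SignConeExactConeRigidity

/-- **Stub 4a — `pdLaplace` (positive-definiteness ⇒ the one-sided Laplace transform of the translate form is
Carathéodory).**  For a Weil test `g` put `K = g ⋆ g̃` and `f(y) := ⟨D, K(· − y)⟩ :=
K(−y) + (polar + archimedean)(K(· − y)) − P_c(K(· − y))` (`K(· − y) = weilTranslate K y`; `f` is bounded and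
continuous — `norm_fakeForm_weilTranslate_le`, landed).  Unit slack makes `(y₁, y₂) ↦ f(y₁ − y₂)` a positive
semidefinite kernel (the form is PSD on translate combs), hence `Re ∫₀^∞ f(y) e^{-zy} dy ≥ 0` for `Re z > 0`
(half-plane Herglotz–Bochner positivity, `re_laplace_nonneg_of_posDef`; this is the case `κ = 1` of
`re_laplace_fakeForm_translate_nonneg`). [folklore] -/
theorem stub_pdLaplace :
    ∀ c : ℕ → ℝ, (∀ n, 0 ≤ c n) →
      (∀ g : ℝ → ℂ, IsWeilTest g →
        -(∫ t, ‖g t‖ ^ 2) ≤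
          (weilPolarTerm (weilConv g (weilReflect g)) + weilArchTerm (weilConv g (weilReflect g)) -
            ∑' n : ℕ, ((c n : ℝ) : ℂ) / (Real.sqrt n : ℂ) *
              (weilConv g (weilReflect g) (Real.log n) + weilConv g (weilReflect g) (-Real.log n))).re) →
      ∀ g : ℝ → ℂ, IsWeilTest g → ∀ z : ℂ, 0 < z.re →
        0 ≤ (∫ x in Set.Ioi (0 : ℝ),
          (weilTranslate (weilConv g (weilReflect g)) x 0 +
              weilPolarTerm (weilTranslate (weilConv g (weilReflect g)) x) +
              weilArchTerm (weilTranslate (weilConv g (weilReflect g)) x) -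
              ∑' n : ℕ, ((c n : ℝ) : ℂ) / (Real.sqrt n : ℂ) *
                (weilTranslate (weilConv g (weilReflect g)) x (Real.log n) +
                  weilTranslate (weilConv g (weilReflect g)) x (-Real.log n))) *
            Complex.exp (-(z * x))).re := by
  intro c _ hU g hg z hz
  -- unit slack is `κ`-slack feasibility with `κ = 1`
  have hU₁ : ∀ φ : ℝ → ℂ, IsWeilTest φ →
      -((1 : ℝ) * ∫ t, ‖φ t‖ ^ 2) ≤
        (weilPolarTerm (weilConv φ (weilReflect φ)) + weilArchTerm (weilConv φ (weilReflect φ)) -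
          ∑' n : ℕ, ((c n : ℝ) : ℂ) / (Real.sqrt n : ℂ) *
            (weilConv φ (weilReflect φ) (Real.log n) + weilConv φ (weilReflect φ) (-Real.log n))).re := by
    intro φ hφ
    rw [one_mul]
    exact hU φ hφ
  have h := re_laplace_fakeForm_translate_nonneg hU₁ hg hz
  -- match the integrands: `K(-x) + W_ar - P_c = W_ar - P_c + (1 : ℝ) • K(-x)`
  refine h.trans_eq ?_
  congr 1
  refine integral_congr_ae (Eventually.of_forall fun x => ?_)
  push_cast
  ring

end Summit.RiemannHypothesis.RiemannHypothesis.Theorems.SignConeConeMagnification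

end
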